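import Summits.AtomisticToContinuum.BoseEinsteinCondensation.Theorems.BECInsertionCorrectorStaticResponseBoundFewBodyWindow
import HarnessLib

/-!
# The QUINTIC few-body window of crux `BECInsertionCorrector.StaticResponseBound`
# (stmt-AtomisticToContinuum-12057, line `stable-fraction-square-completion`, seat a1 layer): stub `stub_fewBodyWindow5`

At side length `L = (N/ρ)^{1/3}` and scattering length `a = (scatteringLength v).toReal`, the window
`N⁵ · ρa³ ≤ c(v)` forces, for every admissible `v`, all small `ρ` and all `N ≥ 1`,

* the FEW-BODY regime `E₀^per(v,N,L) · L² ≤ 4π²/5` (no factor `N`, seat-a1 analysis): for `N ≥ 2` the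
  Dyson–LSSY periodic upper bound `E₀^per ≤ K ρ a N` along `L = (N/ρ)^{1/3}`
  (`FewBody.exists_groundStateEnergy_toReal_le`, from [LSSY2005, Thm. 2.2 (2.14)]) gives
  `(E₀·L²)³ ≤ K³ρ³a³N³L⁶ = K³·N⁵ρa³ ≤ K³c ≤ (4π²/5)³`; for `N = 1`, `E₀ = 0`
  (`periodicGroundStateEnergy_one`);
* the ULTRAVIOLET branch `ρa ≤ |p|²` for every `k ≠ 0`: `(ρaL²)³ = ρa³N² ≤ N⁵ρa³ ≤ c ≤ (4π²)³`, so
  `ρa ≤ (2π/L)² ≤ |p|²` (`sq_div_le_psq`).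

All estimates are cubed, so no fractional powers beyond `L³ = N/ρ` (`sideLength_pow_three`) enter.  A direct
adaptation (exponent `8 ↦ 5`, energy factor `N` dropped) of the landed octic window `FewBody.stub_fewBodyWindow`.
-/

noncomputable section

namespace Summit.AtomisticToContinuum.BoseEinsteinCondensation.Cruxes.StaticResponseBound.FewBody5

open MeasureTheory Filter
open scoped ENNReal NNReal BigOperators
open Literature.MathematicalPhysics.QuantumManyBody.BoseGas
open Summit.AtomisticToContinuum.BoseEinsteinCondensation.Theses
open Summit.AtomisticToContinuum.BoseEinsteinCondensation.Theses.BECInsertionCorrector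
open Summit.AtomisticToContinuum.BoseEinsteinCondensation.Theorems.StaticResponseBound.Negative
open Summit.AtomisticToContinuum.BoseEinsteinCondensation.Cruxes.StaticResponseBound.UvThomsonForceWave
open Summit.AtomisticToContinuum.BoseEinsteinCondensation.Cruxes.StaticResponseBound.FewBody

/-! ## Real arithmetic of the quintic window (everything cubed) -/

/-- The quintic few-body energy arithmetic: `(KρaN) · L² ≤ 4π²/5` once `L³ = N/ρ`,
`N⁵ρa³ ≤ c ≤ (4π²/(5K))³` (cube: `(KρaNL²)³ = K³ N⁵ ρa³`). [folklore] -/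
theorem w5_energy_window_le {K ρ a c L N : ℝ} (hK : 0 < K) (hρ : 0 < ρ) (hL3 : L ^ 3 = N / ρ)
    (hwin : N ^ 5 * (ρ * a ^ 3) ≤ c) (hc : c ≤ (4 * Real.pi ^ 2 / (5 * K)) ^ 3) :
    K * ρ * a * N * L ^ 2 ≤ 4 * Real.pi ^ 2 / 5 := by
  refine le_of_pow_le_pow_left₀ three_ne_zero (by positivity) ?_
  have hL6 : (L ^ 2) ^ 3 = (N / ρ) ^ 2 := by rw [← hL3]; ring
  have hX3 : (K * ρ * a * N * L ^ 2) ^ 3 = K ^ 3 * (N ^ 5 * (ρ * a ^ 3)) := by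
    calc (K * ρ * a * N * L ^ 2) ^ 3 = K ^ 3 * ρ ^ 3 * a ^ 3 * N ^ 3 * (L ^ 2) ^ 3 := by ring
      _ = K ^ 3 * ρ ^ 3 * a ^ 3 * N ^ 3 * (N / ρ) ^ 2 := by rw [hL6]
      _ = K ^ 3 * (N ^ 5 * (ρ * a ^ 3)) := by field_simp
  have hY3 : (4 * Real.pi ^ 2 / 5) ^ 3 = K ^ 3 * (4 * Real.pi ^ 2 / (5 * K)) ^ 3 := by
    field_simp
  rw [hX3, hY3]
  exact mul_le_mul_of_nonneg_left (hwin.trans hc) (by positivity)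

/-- The quintic ultraviolet-branch arithmetic: `ρa ≤ (2π/L)²` once `L³ = N/ρ`, `1 ≤ N`,
`N⁵ρa³ ≤ c ≤ (4π²)³` (cube: `(ρaL²)³ = ρa³N² ≤ N⁵ρa³`). [folklore] -/
theorem w5_density_mul_le_sq_div {ρ a c L N : ℝ} (hρ : 0 < ρ) (ha : 0 ≤ a) (hN : 1 ≤ N) (hL : 0 < L)
    (hL3 : L ^ 3 = N / ρ) (hwin : N ^ 5 * (ρ * a ^ 3) ≤ c) (hc : c ≤ (4 * Real.pi ^ 2) ^ 3) :
    ρ * a ≤ (2 * Real.pi / L) ^ 2 := by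
  rw [div_pow, le_div_iff₀ (by positivity)]
  refine le_of_pow_le_pow_left₀ three_ne_zero (by positivity) ?_
  have hL6 : (L ^ 2) ^ 3 = (N / ρ) ^ 2 := by rw [← hL3]; ring
  have hX3 : (ρ * a * L ^ 2) ^ 3 = N ^ 2 * (ρ * a ^ 3) := by
    calc (ρ * a * L ^ 2) ^ 3 = ρ ^ 3 * a ^ 3 * (L ^ 2) ^ 3 := by ring
      _ = ρ ^ 3 * a ^ 3 * (N / ρ) ^ 2 := by rw [hL6]
      _ = N ^ 2 * (ρ * a ^ 3) := by field_simp
  have hN25 : N ^ 2 ≤ N ^ 5 := pow_le_pow_right₀ hN (by norm_num)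
  have hρa : 0 ≤ ρ * a ^ 3 := by positivity
  calc (ρ * a * L ^ 2) ^ 3 = N ^ 2 * (ρ * a ^ 3) := hX3
    _ ≤ N ^ 5 * (ρ * a ^ 3) := mul_le_mul_of_nonneg_right hN25 hρa
    _ ≤ c := hwin
    _ ≤ (4 * Real.pi ^ 2) ^ 3 := hc
    _ = ((2 * Real.pi) ^ 2) ^ 3 := by ring

/-! ## The stub -/

/-- **`FewBodyWindow5`** (stub `stub_fewBodyWindow5` of the seat-a1 layer of line
`stable-fraction-square-completion`): for every admissible `v` there are `ρ₀, c > 0` such that for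
`0 < ρ < ρ₀`, `N ≥ 1` and `N⁵·ρa³ ≤ c` the system at `L = (N/ρ)^{1/3}` is in the few-body regime
`E₀^per(v,N,L)·L² ≤ 4π²/5` (LSSY periodic upper bound `E₀ ≤ KρaN` for `N ≥ 2`, `E₀ = 0` for `N = 1`)
and on the ultraviolet branch `ρa ≤ |p|²` for every `k ≠ 0`. [cite: LSSY2005, Thm. 2.2 (2.14)] -/
theorem stub_fewBodyWindow5 :
    ∀ v : ℝ → ℝ≥0∞, IsRepulsiveFiniteRange v →
      ∃ ρ₀ : ℝ, 0 < ρ₀ ∧ ∃ c : ℝ, 0 < c ∧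
        ∀ ρ : ℝ, 0 < ρ → ρ < ρ₀ → ∀ N : ℕ, 1 ≤ N →
          (N : ℝ) ^ 5 * (ρ * (scatteringLength v).toReal ^ 3) ≤ c →
          (periodicGroundStateEnergy v N (sideLength ρ N)).toReal * sideLength ρ N ^ 2
              ≤ 4 * Real.pi ^ 2 / 5 ∧
          ∀ k : Fin 3 → ℤ, k ≠ 0 → ρ * (scatteringLength v).toReal ≤ psq (sideLength ρ N) k := by
  intro v hv
  obtain ⟨ρ₀, hρ₀, K, hK, hE⟩ := exists_groundStateEnergy_toReal_le hv
  have ha : 0 ≤ (scatteringLength v).toReal := ENNReal.toReal_nonneg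
  refine ⟨ρ₀, hρ₀, min ((4 * Real.pi ^ 2 / (5 * K)) ^ 3) ((4 * Real.pi ^ 2) ^ 3),
    lt_min (by positivity) (by positivity), ?_⟩
  intro ρ hρ hρlt N hN hwin
  have hN0 : 0 < N := hN
  have hL : 0 < sideLength ρ N := sideLength_pos hρ hN0
  have hL3 : sideLength ρ N ^ 3 = N / ρ := sideLength_pow_three hρ N
  have hNR : (1 : ℝ) ≤ N := by exact_mod_cast hN
  refine ⟨?_, fun k hk => ?_⟩
  · rcases Nat.lt_or_ge N 2 with h1 | h2
    · obtain rfl : N = 1 := by omega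
      rw [periodicGroundStateEnergy_one hL v, ENNReal.toReal_zero, zero_mul]
      positivity
    · calc (periodicGroundStateEnergy v N (sideLength ρ N)).toReal * sideLength ρ N ^ 2
          ≤ (K * ρ * (scatteringLength v).toReal * N) * sideLength ρ N ^ 2 := by
            gcongr
            exact hE ρ hρ hρlt N h2
        _ ≤ 4 * Real.pi ^ 2 / 5 :=
            w5_energy_window_le hK hρ hL3 hwin (min_le_left _ _)
  · exact (w5_density_mul_le_sq_div hρ ha hNR hL hL3 hwin (min_le_right _ _)).trans
      (sq_div_le_psq _ hk)

end Summit.AtomisticToContinuum.BoseEinsteinCondensation.Cruxes.StaticResponseBound.FewBody5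

end
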